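import Literature.Analysis.FluidPDE.KwonSpaceTimeFields
import HarnessLib

/-!
# Kwon's Lemma 2.5: the bounds (est.h) of the drift at `r = 3` and `r = ∞`

Analysis/FluidPDE proof file (theorems only; no definitions, no named facts) on the discharge
path of the named fact `Literature.Analysis.FluidPDE.kwon2023_velocity_epsilon_regularity`
(`PressureFreeEpsilonRegularity.lean`; H. Kwon, J. Differential Equations 357 (2023) =
arXiv:2104.03160, Thm. 1.4 with `r = m = 3`). Its accepted §4 assembly
(`kwon2023_velocity_epsilon_regularity_of_lemma25_of_thm31`, `PressureFreeEpsilonRegularityAssembly.lean`)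
asks of Lemma 2.5, among other things, that the drift `h` of the decomposition `u = v + h` be
essentially bounded on `Q_{1/2}(0)` and satisfy
`‖h‖_{L³_t W^{1,∞}_x(Q₁(0))} ≤ C₁ ‖u‖_{L³(Q₂(0))}`. For the tree's drift — Kwon's
`h(t, ·) = H(W(t))`, the harmonic part of the slices of a good representative `W` of the velocity
(`Kwon2023.driftField`, `Kwon2023.driftGrad`, `Kwon2023.IsGoodVelocity`, `KwonSpaceTimeFields.lean`)
— both follow from the accepted uniform bounds `‖h(t,x)‖, ‖∇h(t,x)‖ ≤ C ‖W(t)‖_{L¹(B₂)}`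
(`exists_norm_driftField_le`, `exists_norm_driftGrad_le`; Kwon's (est.h), Remark 2.3 (2.3)):

* `Kwon2023.exists_forall_norm_driftField_le`, `…_driftGrad_le`,
  `Kwon2023.eLpNorm_driftField_top_lt_top` — (est.h) with `r = ∞`, `k = 0, 1`: `h` and `∇h` are
  bounded on all of space–time by `C (|B₂| + sup_t ‖W(t)‖²_{L²})/2` (`‖W‖ ≤ (1 + ‖W‖²)/2` and
  the uniform `L²` bound of a good velocity), hence `h ∈ L^∞(μ)` for every measure `μ` — in
  particular on `Q_{1/2}(0)` ("`‖∇ᵏh‖_{L^∞((−t₀,0)×B₁)} ≲_k ‖u‖_{L^∞(−t₀,0;L¹(B₂))}`", Lemma 2.5).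
* `Kwon2023.exists_driftNorm_le` — (est.h) with `r = 3`, `k = 0, 1`, in the form of the assembly:
  there is an absolute `C > 0` with
  `(∫_{−1}^{0} (‖h(t)‖_{L^∞(B₁)} + ‖∇h(t)‖_{L^∞(B₁)})³ dt)^{1/3} ≤ C ‖W‖_{L³(Q₂(0))}`
  for every good velocity `W` (Hölder `‖W(t)‖_{L¹(B₂)} ≤ |B₂|^{2/3} ‖W(t)‖_{L³(B₂)}`, Tonelli on
  `Q₂(0) = (−4,0) × B₂`; "`‖∇ᵏh‖_{L^r(a,b;L^∞(B₁))} ≲_k ‖u‖_{L^r(a,b;L¹(B₂))}`", Lemma 2.5 (est.h),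
  and `‖u‖_{L³_tL¹_x} ≲ ‖u‖_{L³(Q₂)}` as used in §4).

## Mathlib / tree search

Reused: `Kwon2023.IsGoodVelocity` (`integrable`, `integrable_sq`, `eq_zero`, `sq_le_uniform`,
`stronglyMeasurable`), `driftField`, `driftGrad`, `exists_norm_driftField_le`,
`exists_norm_driftGrad_le` (`KwonSpaceTimeFields`). Mathlib: `eLpNormEssSup_le_of_ae_bound`,
`eLpNorm_le_eLpNorm_mul_rpow_measure_univ`, `eLpNorm_one_eq_lintegral_enorm`,
`ofReal_integral_norm_eq_lintegral_enorm`, `setLIntegral_prod`, `Measure.volume_eq_prod`.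

## References

* H. Kwon, J. Differential Equations 357 (2023) 1–31 = arXiv:2104.03160: Lemma 2.5 (est.h),
  Remark 2.3 (2.3), §4 (arXiv pp. 7, 6, 15). [Kwon2023RolePressure]
-/

noncomputable section

open MeasureTheory Set Function Filter Topology TopologicalSpace Metric
open scoped ENNReal NNReal

namespace Literature.Analysis.FluidPDE

namespace Kwon2023

variable {W : ℝ → EuclideanSpace ℝ (Fin 3) → EuclideanSpace ℝ (Fin 3)}

/-! ### (est.h) with `r = ∞`: `h` and `∇h` are bounded -/

/-- The `L¹(B₂)` norms of the slices of a good velocity are uniformly bounded: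
`∫_{B₂} ‖W(t)‖ ≤ (|B₂| + A)/2` if `∫ ‖W(t)‖² ≤ A` for all `t` (`‖w‖ ≤ (1 + ‖w‖²)/2`). [folklore] -/
private theorem integral_ball_norm_le (hW : IsGoodVelocity W) {A : ℝ} (hA : ∀ t, ∫ x, ‖W t x‖ ^ 2 ≤ A)
    (t : ℝ) :
    ∫ y in ball (0 : EuclideanSpace ℝ (Fin 3)) 2, ‖W t y‖ ≤
      (volume (ball (0 : EuclideanSpace ℝ (Fin 3)) 2)).toReal / 2 + A / 2 := by
  have hfin : volume (ball (0 : EuclideanSpace ℝ (Fin 3)) 2) < ⊤ := measure_ball_lt_top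
  have h1 : ∫ y in ball (0 : EuclideanSpace ℝ (Fin 3)) 2, ‖W t y‖ ≤
      ∫ y in ball (0 : EuclideanSpace ℝ (Fin 3)) 2, (1 / 2 + ‖W t y‖ ^ 2 / 2) := by
    have hc1 : Integrable (fun _ : EuclideanSpace ℝ (Fin 3) => (1 / 2 : ℝ))
        (volume.restrict (ball (0 : EuclideanSpace ℝ (Fin 3)) 2)) := integrableOn_const hfin.ne
    have hc2 : Integrable (fun y => ‖W t y‖ ^ 2 / 2)
        (volume.restrict (ball (0 : EuclideanSpace ℝ (Fin 3)) 2)) :=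
      ((hW.integrable_sq t).div_const 2).integrableOn
    refine integral_mono (hW.integrable t).norm.integrableOn (hc1.add hc2) ?_
    intro y
    dsimp only
    nlinarith [sq_nonneg (‖W t y‖ - 1)]
  refine h1.trans ?_
  have hc1 : Integrable (fun _ : EuclideanSpace ℝ (Fin 3) => (1 / 2 : ℝ))
      (volume.restrict (ball (0 : EuclideanSpace ℝ (Fin 3)) 2)) := integrableOn_const hfin.ne
  have hc2 : Integrable (fun y => ‖W t y‖ ^ 2 / 2)
      (volume.restrict (ball (0 : EuclideanSpace ℝ (Fin 3)) 2)) :=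
    ((hW.integrable_sq t).div_const 2).integrableOn
  rw [integral_add hc1 hc2, setIntegral_const, integral_div, smul_eq_mul]
  have h2 : ∫ y in ball (0 : EuclideanSpace ℝ (Fin 3)) 2, ‖W t y‖ ^ 2 ≤ A :=
    (setIntegral_le_integral (hW.integrable_sq t) (Eventually.of_forall fun y => by positivity)).trans
      (hA t)
  have h3 : (volume.real (ball (0 : EuclideanSpace ℝ (Fin 3)) 2)) =
      (volume (ball (0 : EuclideanSpace ℝ (Fin 3)) 2)).toReal := rfl
  rw [h3]
  linarith

/-- **(est.h), `r = ∞`, `k = 0`: the drift is bounded on space–time.** For a good velocity `W`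
(`∫ ‖W(t)‖² ≤ A` for all `t`), `‖h(t, x)‖ ≤ C (|B₂| + A)/2` for all `t, x`, where `C` is the
constant of `exists_norm_driftField_le`. [cite: Kwon2023RolePressure, Lemma 2.5 (est.h) with r = ∞, k = 0] -/
theorem exists_forall_norm_driftField_le (hW : IsGoodVelocity W) :
    ∃ M : ℝ, ∀ t x, ‖driftField W t x‖ ≤ M := by
  obtain ⟨C, hC0, hC⟩ := exists_norm_driftField_le
  obtain ⟨A, hA⟩ := hW.sq_le_uniform
  refine ⟨C * ((volume (ball (0 : EuclideanSpace ℝ (Fin 3)) 2)).toReal / 2 + A / 2), fun t x => ?_⟩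
  exact (hC W hW t x).trans (mul_le_mul_of_nonneg_left (integral_ball_norm_le hW hA t) hC0)

/-- **(est.h), `r = ∞`, `k = 1`: the drift gradient is bounded on space–time.** [cite: Kwon2023RolePressure, Lemma 2.5 (est.h) with r = ∞, k = 1] -/
theorem exists_forall_norm_driftGrad_le (hW : IsGoodVelocity W) :
    ∃ M : ℝ, ∀ t x, ‖driftGrad W t x‖ ≤ M := by
  obtain ⟨C, hC0, hC⟩ := exists_norm_driftGrad_le
  obtain ⟨A, hA⟩ := hW.sq_le_uniform
  refine ⟨C * ((volume (ball (0 : EuclideanSpace ℝ (Fin 3)) 2)).toReal / 2 + A / 2), fun t x => ?_⟩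
  exact (hC W hW t x).trans (mul_le_mul_of_nonneg_left (integral_ball_norm_le hW hA t) hC0)

/-- **The drift is essentially bounded** for every measure on space–time, in particular
`h ∈ L^∞(Q_{1/2}(0))` — the qualitative form of (est.h) used by the §4 assembly. [cite: Kwon2023RolePressure, Lemma 2.5 (est.h) with r = ∞, k = 0] -/
theorem eLpNorm_driftField_top_lt_top (hW : IsGoodVelocity W)
    (μ : Measure (ℝ × EuclideanSpace ℝ (Fin 3))) :
    eLpNorm (uncurry (driftField W)) ∞ μ < ⊤ := by
  obtain ⟨M, hM⟩ := exists_forall_norm_driftField_le hW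
  rw [eLpNorm_exponent_top]
  exact eLpNormEssSup_lt_top_of_ae_bound (C := M) (Eventually.of_forall fun z => hM z.1 z.2)

/-! ### (est.h) with `r = 3`: the `L³_t W^{1,∞}_x(Q₁)` bound by `‖W‖_{L³(Q₂)}` -/

/-- Slice-wise: `‖h(t)‖_{L^∞(μ)} + ‖∇h(t)‖_{L^∞(μ)} ≤ (C_h + C_g) |B₂|^{2/3} ‖W(t)‖_{L³(B₂)}` for any
measure `μ` on space (the sup bounds hold everywhere), by (est.h) and Hölder on `B₂`. [folklore] -/
private theorem driftNorm_slice_le {Ch Cg : ℝ} (hCh0 : 0 ≤ Ch) (hCg0 : 0 ≤ Cg)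
    (hCh : ∀ (W : ℝ → EuclideanSpace ℝ (Fin 3) → EuclideanSpace ℝ (Fin 3)), IsGoodVelocity W →
      ∀ t x, ‖driftField W t x‖ ≤ Ch * ∫ y in ball (0 : EuclideanSpace ℝ (Fin 3)) 2, ‖W t y‖)
    (hCg : ∀ (W : ℝ → EuclideanSpace ℝ (Fin 3) → EuclideanSpace ℝ (Fin 3)), IsGoodVelocity W →
      ∀ t x, ‖driftGrad W t x‖ ≤ Cg * ∫ y in ball (0 : EuclideanSpace ℝ (Fin 3)) 2, ‖W t y‖)
    (hW : IsGoodVelocity W) (μ : Measure (EuclideanSpace ℝ (Fin 3))) (t : ℝ) :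
    eLpNorm (driftField W t) ∞ μ + eLpNorm (driftGrad W t) ∞ μ ≤
      ENNReal.ofReal (Ch + Cg) * volume (ball (0 : EuclideanSpace ℝ (Fin 3)) 2) ^ (2 / 3 : ℝ) *
        eLpNorm (W t) 3 (volume.restrict (ball (0 : EuclideanSpace ℝ (Fin 3)) 2)) := by
  set I : ℝ := ∫ y in ball (0 : EuclideanSpace ℝ (Fin 3)) 2, ‖W t y‖ with hI
  have hI0 : 0 ≤ I := integral_nonneg fun y => norm_nonneg _
  -- the two sup bounds
  have h1 : eLpNorm (driftField W t) ∞ μ ≤ ENNReal.ofReal (Ch * I) := by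
    rw [eLpNorm_exponent_top]
    exact eLpNormEssSup_le_of_ae_bound (Eventually.of_forall fun x => hCh W hW t x)
  have h2 : eLpNorm (driftGrad W t) ∞ μ ≤ ENNReal.ofReal (Cg * I) := by
    rw [eLpNorm_exponent_top]
    exact eLpNormEssSup_le_of_ae_bound (Eventually.of_forall fun x => hCg W hW t x)
  have h12 : eLpNorm (driftField W t) ∞ μ + eLpNorm (driftGrad W t) ∞ μ ≤
      ENNReal.ofReal (Ch + Cg) * ENNReal.ofReal I := by
    refine (add_le_add h1 h2).trans (le_of_eq ?_)
    rw [← ENNReal.ofReal_add (by positivity) (by positivity), ← ENNReal.ofReal_mul (by positivity)]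
    congr 1
    ring
  -- Hölder on `B₂`: `I = ‖W(t)‖_{L¹(B₂)} ≤ |B₂|^{2/3} ‖W(t)‖_{L³(B₂)}`
  have h3 : ENNReal.ofReal I ≤ volume (ball (0 : EuclideanSpace ℝ (Fin 3)) 2) ^ (2 / 3 : ℝ) *
      eLpNorm (W t) 3 (volume.restrict (ball (0 : EuclideanSpace ℝ (Fin 3)) 2)) := by
    rw [hI, ofReal_integral_norm_eq_lintegral_enorm (hW.integrableOn_slice t),
      ← eLpNorm_one_eq_lintegral_enorm]
    have h := eLpNorm_le_eLpNorm_mul_rpow_measure_univ (p := 1) (q := 3)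
      (μ := volume.restrict (ball (0 : EuclideanSpace ℝ (Fin 3)) 2)) (by norm_num)
      ((hW.aestronglyMeasurable_slice t).restrict)
    rw [Measure.restrict_apply_univ] at h
    have e : (1 / (1 : ℝ≥0∞).toReal - 1 / (3 : ℝ≥0∞).toReal : ℝ) = 2 / 3 := by norm_num
    rw [e] at h
    rw [mul_comm]
    exact h
  calc eLpNorm (driftField W t) ∞ μ + eLpNorm (driftGrad W t) ∞ μ
      ≤ ENNReal.ofReal (Ch + Cg) * ENNReal.ofReal I := h12
    _ ≤ ENNReal.ofReal (Ch + Cg) * (volume (ball (0 : EuclideanSpace ℝ (Fin 3)) 2) ^ (2 / 3 : ℝ) *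
        eLpNorm (W t) 3 (volume.restrict (ball (0 : EuclideanSpace ℝ (Fin 3)) 2))) := by
        gcongr
    _ = _ := by rw [mul_assoc]

/-- `Q₂(0) = (−4, 0) × B₂(0)`. [folklore] -/
private theorem parabolicCylinder_two_zero :
    parabolicCylinder 2 (0 : ℝ × EuclideanSpace ℝ (Fin 3)) =
      Ioo (-4 : ℝ) 0 ×ˢ ball (0 : EuclideanSpace ℝ (Fin 3)) 2 := by
  rw [parabolicCylinder]
  norm_num

/-- **(est.h), `r = 3`, `k = 0, 1`, in the form of the §4 assembly.** There is an absolute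
`C > 0` such that for every good velocity `W` (a representative of the velocity on
`Q₂ = (−4,0) × B₂`, zero off `B₂`), Kwon's drift `h(t) = H(W(t))` satisfies
`(∫_{−1}^{0} (‖h(t)‖_{L^∞(B₁)} + ‖∇h(t)‖_{L^∞(B₁)})³ dt)^{1/3} ≤ C ‖W‖_{L³(Q₂(0))}`:
(est.h) "`‖∇ᵏh‖_{L^r(a,b;L^∞(B₁))} ≲_k ‖u‖_{L^r(a,b;L¹(B₂))}`" with `r = 3`, `(a,b) = (−1,0)`,
followed by Hölder on `B₂` and Tonelli, as in §4 ("`‖h‖_{L^r_tW^{1,∞}_x(Q₁)} ≲ ‖u‖_{L^r_tL^m_x(Q₂)}`").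
[cite: Kwon2023RolePressure, Lemma 2.5 (est.h) with r = 3; §4 (arXiv p. 15)] -/
theorem exists_driftNorm_le :
    ∃ C : ℝ, 0 < C ∧ ∀ (W : ℝ → EuclideanSpace ℝ (Fin 3) → EuclideanSpace ℝ (Fin 3)),
      IsGoodVelocity W →
      (∫⁻ t in Ioo (-1 : ℝ) 0, (eLpNorm (driftField W t) ∞
          (volume.restrict (ball (0 : EuclideanSpace ℝ (Fin 3)) 1)) +
        eLpNorm (driftGrad W t) ∞ (volume.restrict (ball (0 : EuclideanSpace ℝ (Fin 3)) 1))) ^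
          (3 : ℝ)) ^ (1 / 3 : ℝ) ≤
        ENNReal.ofReal C * eLpNorm (uncurry W) 3
          (volume.restrict (parabolicCylinder 2 (0 : ℝ × EuclideanSpace ℝ (Fin 3)))) := by
  obtain ⟨Ch, hCh0, hCh⟩ := exists_norm_driftField_le
  obtain ⟨Cg, hCg0, hCg⟩ := exists_norm_driftGrad_le
  -- the constant: `(C_h + C_g + 1) |B₂|^{2/3}`
  set B : Set (EuclideanSpace ℝ (Fin 3)) := ball (0 : EuclideanSpace ℝ (Fin 3)) 2 with hB
  have hBfin : volume B ≠ ⊤ := measure_ball_lt_top.ne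
  have hBpos : 0 < (volume B).toReal :=
    ENNReal.toReal_pos (measure_ball_pos volume _ (by norm_num)).ne' hBfin
  set k : ℝ := (volume B).toReal ^ (2 / 3 : ℝ) with hk
  have hk0 : 0 < k := Real.rpow_pos_of_pos hBpos _
  have hK : (volume B) ^ (2 / 3 : ℝ) = ENNReal.ofReal k := by
    rw [hk, ← ENNReal.ofReal_rpow_of_nonneg hBpos.le (by norm_num), ENNReal.ofReal_toReal hBfin]
  set c : ℝ≥0∞ := ENNReal.ofReal (Ch + Cg) * (volume B) ^ (2 / 3 : ℝ) with hc
  have hc' : c = ENNReal.ofReal ((Ch + Cg) * k) := by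
    rw [hc, hK, ← ENNReal.ofReal_mul (by positivity)]
  have hctop : c ≠ ⊤ := by rw [hc']; exact ENNReal.ofReal_ne_top
  refine ⟨(Ch + Cg + 1) * k, by positivity, fun W hW => ?_⟩
  -- ### slice-wise bound and its cube
  set N : ℝ → ℝ≥0∞ := fun t => eLpNorm (W t) 3 (volume.restrict B) with hN
  have hN3 : ∀ t, N t ^ (3 : ℝ) = ∫⁻ y in B, ‖W t y‖ₑ ^ (3 : ℝ) := by
    intro t
    rw [hN]
    dsimp only
    rw [eLpNorm_eq_lintegral_rpow_enorm_toReal (by norm_num) (by norm_num), ENNReal.toReal_ofNat,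
      ← ENNReal.rpow_mul]
    norm_num
  have hslice : ∀ t, (eLpNorm (driftField W t) ∞
      (volume.restrict (ball (0 : EuclideanSpace ℝ (Fin 3)) 1)) +
      eLpNorm (driftGrad W t) ∞ (volume.restrict (ball (0 : EuclideanSpace ℝ (Fin 3)) 1))) ^
        (3 : ℝ) ≤ c ^ (3 : ℝ) * ∫⁻ y in B, ‖W t y‖ₑ ^ (3 : ℝ) := by
    intro t
    have h := driftNorm_slice_le hCh0 hCg0 hCh hCg hW
      (volume.restrict (ball (0 : EuclideanSpace ℝ (Fin 3)) 1)) t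
    calc _ ≤ (c * N t) ^ (3 : ℝ) := by gcongr
      _ = c ^ (3 : ℝ) * N t ^ (3 : ℝ) := ENNReal.mul_rpow_of_nonneg _ _ (by norm_num)
      _ = _ := by rw [hN3]
  -- ### integrate in time and use Tonelli on `Q₂(0) = (−4,0) × B₂`
  have hmeas : AEMeasurable (fun z : ℝ × EuclideanSpace ℝ (Fin 3) => ‖uncurry W z‖ₑ ^ (3 : ℝ))
      (((volume : Measure ℝ).prod (volume : Measure (EuclideanSpace ℝ (Fin 3)))).restrict
        (Ioo (-4 : ℝ) 0 ×ˢ B)) :=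
    (hW.stronglyMeasurable.measurable.enorm.pow_const _).aemeasurable
  have hT : ∫⁻ t in Ioo (-4 : ℝ) 0, ∫⁻ y in B, ‖W t y‖ₑ ^ (3 : ℝ) =
      ∫⁻ z in parabolicCylinder 2 (0 : ℝ × EuclideanSpace ℝ (Fin 3)), ‖uncurry W z‖ₑ ^ (3 : ℝ) := by
    rw [parabolicCylinder_two_zero, Measure.volume_eq_prod, setLIntegral_prod _ hmeas]
    rfl
  have hX : ∫⁻ z in parabolicCylinder 2 (0 : ℝ × EuclideanSpace ℝ (Fin 3)), ‖uncurry W z‖ₑ ^ (3 : ℝ) =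
      eLpNorm (uncurry W) 3
        (volume.restrict (parabolicCylinder 2 (0 : ℝ × EuclideanSpace ℝ (Fin 3)))) ^ (3 : ℝ) := by
    rw [eLpNorm_eq_lintegral_rpow_enorm_toReal (by norm_num) (by norm_num), ENNReal.toReal_ofNat,
      ← ENNReal.rpow_mul]
    norm_num
  have hint : ∫⁻ t in Ioo (-1 : ℝ) 0, (eLpNorm (driftField W t) ∞
      (volume.restrict (ball (0 : EuclideanSpace ℝ (Fin 3)) 1)) +
      eLpNorm (driftGrad W t) ∞ (volume.restrict (ball (0 : EuclideanSpace ℝ (Fin 3)) 1))) ^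
        (3 : ℝ) ≤ c ^ (3 : ℝ) * eLpNorm (uncurry W) 3
          (volume.restrict (parabolicCylinder 2 (0 : ℝ × EuclideanSpace ℝ (Fin 3)))) ^ (3 : ℝ) := by
    calc _ ≤ ∫⁻ t in Ioo (-1 : ℝ) 0, c ^ (3 : ℝ) * ∫⁻ y in B, ‖W t y‖ₑ ^ (3 : ℝ) :=
          lintegral_mono fun t => hslice t
      _ ≤ ∫⁻ t in Ioo (-4 : ℝ) 0, c ^ (3 : ℝ) * ∫⁻ y in B, ‖W t y‖ₑ ^ (3 : ℝ) :=
          lintegral_mono_set (Ioo_subset_Ioo (by norm_num) le_rfl)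
      _ = c ^ (3 : ℝ) * ∫⁻ t in Ioo (-4 : ℝ) 0, ∫⁻ y in B, ‖W t y‖ₑ ^ (3 : ℝ) := by
          rw [lintegral_const_mul' _ _ (ENNReal.rpow_ne_top_of_nonneg (by norm_num) hctop)]
      _ = _ := by rw [hT, hX]
  -- ### take cube roots
  have hroot : (∫⁻ t in Ioo (-1 : ℝ) 0, (eLpNorm (driftField W t) ∞
      (volume.restrict (ball (0 : EuclideanSpace ℝ (Fin 3)) 1)) +
      eLpNorm (driftGrad W t) ∞ (volume.restrict (ball (0 : EuclideanSpace ℝ (Fin 3)) 1))) ^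
        (3 : ℝ)) ^ (1 / 3 : ℝ) ≤ c * eLpNorm (uncurry W) 3
          (volume.restrict (parabolicCylinder 2 (0 : ℝ × EuclideanSpace ℝ (Fin 3)))) := by
    calc _ ≤ (c ^ (3 : ℝ) * eLpNorm (uncurry W) 3
          (volume.restrict (parabolicCylinder 2 (0 : ℝ × EuclideanSpace ℝ (Fin 3)))) ^ (3 : ℝ)) ^
            (1 / 3 : ℝ) := by gcongr
      _ = _ := by
          rw [ENNReal.mul_rpow_of_nonneg _ _ (by norm_num), ← ENNReal.rpow_mul, ← ENNReal.rpow_mul]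
          norm_num
  refine hroot.trans ?_
  gcongr
  rw [hc']
  exact ENNReal.ofReal_le_ofReal (by nlinarith)

/-! ### The drift class of Def. 2.4 and (est.v) at `r = 3` -/

/-- **The drift class `h ∈ L²_t L^∞_x` of Def. 2.4 on a parabolic cylinder.** For a good velocity
`W`, the slices of `1_{Q_r(z₀)} h` have `L^∞` norms bounded by `M 1_{(t₀ − r², t₀)}(t)`, so
`∫ ‖1_{Q_r(z₀)} h(t)‖²_{L^∞} dt ≤ M² r² < ∞` — the `driftClass` clause of
`Kwon2023.IsPerturbedSuitableOn` for Kwon's drift on any cylinder (Lemma 2.5: `h` is the drift of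
the perturbed system on `(−4,0) × B₁`). [cite: Kwon2023RolePressure, Lemma 2.5 (est.h) with r = ∞ and Def. 2.4] -/
theorem lintegral_eLpNorm_indicator_driftField_sq_lt_top (hW : IsGoodVelocity W) (r : ℝ)
    (z₀ : ℝ × EuclideanSpace ℝ (Fin 3)) :
    ∫⁻ t, eLpNorm (fun x => (parabolicCylinder r z₀).indicator (uncurry (driftField W)) (t, x)) ∞
      (volume : Measure (EuclideanSpace ℝ (Fin 3))) ^ (2 : ℕ) < ∞ := by
  obtain ⟨M, hM⟩ := exists_forall_norm_driftField_le hW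
  have hM0 : 0 ≤ M := (norm_nonneg _).trans (hM 0 0)
  set J : Set ℝ := Ioo (z₀.1 - r ^ 2) z₀.1 with hJ
  -- slice bound: `‖1_Q h(t)‖_∞ ≤ M 1_J(t)`
  have hpt : ∀ t, eLpNorm (fun x => (parabolicCylinder r z₀).indicator (uncurry (driftField W)) (t, x))
      ∞ (volume : Measure (EuclideanSpace ℝ (Fin 3))) ≤ J.indicator (fun _ => ENNReal.ofReal M) t := by
    intro t
    by_cases ht : t ∈ J
    · rw [indicator_of_mem ht, eLpNorm_exponent_top]
      refine eLpNormEssSup_le_of_ae_bound (Eventually.of_forall fun x => ?_)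
      exact (norm_indicator_le_norm_self _ _).trans (hM t x)
    · rw [indicator_of_notMem ht]
      have h0 : (fun x => (parabolicCylinder r z₀).indicator (uncurry (driftField W)) (t, x)) =
          fun _ => 0 := by
        funext x
        rw [indicator_of_notMem]
        rw [mem_parabolicCylinder]
        exact fun h => ht h.1
      rw [h0, eLpNorm_zero']
  have hpt2 : ∀ t, eLpNorm (fun x => (parabolicCylinder r z₀).indicator (uncurry (driftField W)) (t, x))
      ∞ (volume : Measure (EuclideanSpace ℝ (Fin 3))) ^ (2 : ℕ) ≤
      J.indicator (fun _ => ENNReal.ofReal M ^ (2 : ℕ)) t := by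
    intro t
    refine (pow_le_pow_left' (hpt t) 2).trans (le_of_eq ?_)
    by_cases ht : t ∈ J
    · rw [indicator_of_mem ht, indicator_of_mem ht]
    · rw [indicator_of_notMem ht, indicator_of_notMem ht, zero_pow two_ne_zero]
  refine lt_of_le_of_lt (lintegral_mono hpt2) ?_
  rw [lintegral_indicator_const measurableSet_Ioo, Real.volume_Ioo]
  exact ENNReal.mul_lt_top (ENNReal.pow_lt_top ENNReal.ofReal_lt_top) ENNReal.ofReal_lt_top

/-- `Q₁(0) = (−1, 0) × B₁(0)`. [folklore] -/
private theorem parabolicCylinder_one_zero :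
    parabolicCylinder 1 (0 : ℝ × EuclideanSpace ℝ (Fin 3)) =
      Ioo (-1 : ℝ) 0 ×ˢ ball (0 : EuclideanSpace ℝ (Fin 3)) 1 := by
  rw [parabolicCylinder]
  norm_num

/-- `Q₁(0) ⊆ Q₂(0)`. [folklore] -/
private theorem parabolicCylinder_one_subset_two :
    parabolicCylinder 1 (0 : ℝ × EuclideanSpace ℝ (Fin 3)) ⊆ parabolicCylinder 2 0 := by
  rw [parabolicCylinder_one_zero, parabolicCylinder_two_zero]
  exact prod_mono (Ioo_subset_Ioo (by norm_num) le_rfl) (ball_subset_ball (by norm_num))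

/-- Hölder on `B₂`: `∫_{B₂} ‖W(t)‖ ≤ |B₂|^{2/3} ‖W(t)‖_{L³(B₂)}`, in `ℝ≥0∞`. [folklore] -/
private theorem ofReal_integral_ball_norm_le (hW : IsGoodVelocity W) (t : ℝ) :
    ENNReal.ofReal (∫ y in ball (0 : EuclideanSpace ℝ (Fin 3)) 2, ‖W t y‖) ≤
      volume (ball (0 : EuclideanSpace ℝ (Fin 3)) 2) ^ (2 / 3 : ℝ) *
        eLpNorm (W t) 3 (volume.restrict (ball (0 : EuclideanSpace ℝ (Fin 3)) 2)) := by
  rw [ofReal_integral_norm_eq_lintegral_enorm (hW.integrableOn_slice t),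
    ← eLpNorm_one_eq_lintegral_enorm]
  have h := eLpNorm_le_eLpNorm_mul_rpow_measure_univ (p := 1) (q := 3)
    (μ := volume.restrict (ball (0 : EuclideanSpace ℝ (Fin 3)) 2)) (by norm_num)
    ((hW.aestronglyMeasurable_slice t).restrict)
  rw [Measure.restrict_apply_univ] at h
  have e : (1 / (1 : ℝ≥0∞).toReal - 1 / (3 : ℝ≥0∞).toReal : ℝ) = 2 / 3 := by norm_num
  rw [e] at h
  rw [mul_comm]
  exact h

/-- **(est.v) at `r = m = 3`, in the form of the §4 assembly.** There is an absolute `C > 0` such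
that for every good velocity `W`, the principal part `v = W − h` (`h(t) = H(W(t))` Kwon's drift,
so that `v(t) = P_φ W(t)` on `B₁`, Remark 2.3) satisfies `‖v‖_{L³(Q₁(0))} ≤ C ‖W‖_{L³(Q₂(0))}`:
`‖v‖ ≤ ‖W‖ + ‖h‖` and `‖h(t)‖_{L³(B₁)} ≤ |B₁|^{1/3} sup|h(t)| ≤ |B₁|^{1/3} C_h |B₂|^{2/3} ‖W(t)‖_{L³(B₂)}`
((est.h), Hölder), integrated over `t ∈ (−1, 0)` (Lemma 2.5 with Remark 2.2 (2.2):
"`‖P_φ g‖_{L^p(Ω₀)} ≲ ‖g‖_{L^p(Ω)}`"; §4: "`‖v‖_{L^r_tL^m_x(Q₁)} ≲ ‖u‖_{L^r_tL^m_x(Q₂)}`" (est.v)).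
[cite: Kwon2023RolePressure, Lemma 2.5 with Remark 2.2 (2.2); §4 (est.v) (arXiv pp. 6, 15)] -/
theorem exists_eLpNorm_sub_driftField_le :
    ∃ C : ℝ, 0 < C ∧ ∀ (W : ℝ → EuclideanSpace ℝ (Fin 3) → EuclideanSpace ℝ (Fin 3)),
      IsGoodVelocity W →
      eLpNorm (uncurry fun t x => W t x - driftField W t x) 3
          (volume.restrict (parabolicCylinder 1 (0 : ℝ × EuclideanSpace ℝ (Fin 3)))) ≤
        ENNReal.ofReal C * eLpNorm (uncurry W) 3
          (volume.restrict (parabolicCylinder 2 (0 : ℝ × EuclideanSpace ℝ (Fin 3)))) := by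
  obtain ⟨Ch, hCh0, hCh⟩ := exists_norm_driftField_le
  -- the constants
  set B : Set (EuclideanSpace ℝ (Fin 3)) := ball (0 : EuclideanSpace ℝ (Fin 3)) 2 with hB
  set B₁ : Set (EuclideanSpace ℝ (Fin 3)) := ball (0 : EuclideanSpace ℝ (Fin 3)) 1 with hB₁
  have hBfin : volume B ≠ ⊤ := measure_ball_lt_top.ne
  have hB₁fin : volume B₁ ≠ ⊤ := measure_ball_lt_top.ne
  have hBpos : 0 < (volume B).toReal :=
    ENNReal.toReal_pos (measure_ball_pos volume _ (by norm_num)).ne' hBfin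
  set k : ℝ := (volume B).toReal ^ (2 / 3 : ℝ) with hk
  set k₁ : ℝ := (volume B₁).toReal ^ (1 / 3 : ℝ) with hk₁
  have hk0 : 0 < k := Real.rpow_pos_of_pos hBpos _
  have hk₁0 : 0 ≤ k₁ := Real.rpow_nonneg ENNReal.toReal_nonneg _
  have hK : volume B ^ (2 / 3 : ℝ) = ENNReal.ofReal k := by
    rw [hk, ← ENNReal.ofReal_rpow_of_nonneg hBpos.le (by norm_num), ENNReal.ofReal_toReal hBfin]
  have hK₁ : volume B₁ ^ (1 / 3 : ℝ) = ENNReal.ofReal k₁ := by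
    rw [hk₁, ← ENNReal.ofReal_rpow_of_nonneg ENNReal.toReal_nonneg (by norm_num),
      ENNReal.ofReal_toReal hB₁fin]
  set c : ℝ≥0∞ := ENNReal.ofReal Ch * volume B ^ (2 / 3 : ℝ) with hc
  have hc' : c = ENNReal.ofReal (Ch * k) := by rw [hc, hK, ← ENNReal.ofReal_mul hCh0]
  have hctop : c ≠ ⊤ := by rw [hc']; exact ENNReal.ofReal_ne_top
  refine ⟨1 + k₁ * (Ch * k), by positivity, fun W hW => ?_⟩
  set μ₁ : Measure (ℝ × EuclideanSpace ℝ (Fin 3)) :=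
    volume.restrict (parabolicCylinder 1 (0 : ℝ × EuclideanSpace ℝ (Fin 3))) with hμ₁
  set μ₂ : Measure (ℝ × EuclideanSpace ℝ (Fin 3)) :=
    volume.restrict (parabolicCylinder 2 (0 : ℝ × EuclideanSpace ℝ (Fin 3))) with hμ₂
  set X : ℝ≥0∞ := eLpNorm (uncurry W) 3 μ₂ with hXdef
  -- ### the triangle inequality
  have hWm : AEStronglyMeasurable (uncurry W) μ₁ := hW.stronglyMeasurable.aestronglyMeasurable
  have hhm : AEStronglyMeasurable (uncurry (driftField W)) μ₁ :=
    (stronglyMeasurable_uncurry_driftField hW).aestronglyMeasurable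
  have htri : eLpNorm (uncurry fun t x => W t x - driftField W t x) 3 μ₁ ≤
      eLpNorm (uncurry W) 3 μ₁ + eLpNorm (uncurry (driftField W)) 3 μ₁ := by
    have e : (uncurry fun t x => W t x - driftField W t x) = uncurry W - uncurry (driftField W) := by
      funext z; rfl
    rw [e]
    exact eLpNorm_sub_le hWm hhm (by norm_num)
  have hW12 : eLpNorm (uncurry W) 3 μ₁ ≤ X :=
    eLpNorm_mono_measure _ (Measure.restrict_mono parabolicCylinder_one_subset_two le_rfl)
  -- ### the drift in `L³(Q₁(0))`
  set N : ℝ → ℝ≥0∞ := fun t => eLpNorm (W t) 3 (volume.restrict B) with hN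
  have hN3 : ∀ t, N t ^ (3 : ℝ) = ∫⁻ y in B, ‖W t y‖ₑ ^ (3 : ℝ) := by
    intro t
    rw [hN]
    dsimp only
    rw [eLpNorm_eq_lintegral_rpow_enorm_toReal (by norm_num) (by norm_num), ENNReal.toReal_ofNat,
      ← ENNReal.rpow_mul]
    norm_num
  have hpt : ∀ t x, ‖driftField W t x‖ₑ ≤ c * N t := by
    intro t x
    rw [← ofReal_norm]
    refine (ENNReal.ofReal_le_ofReal (hCh W hW t x)).trans ?_
    rw [ENNReal.ofReal_mul hCh0, hc, mul_assoc]
    gcongr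
    exact ofReal_integral_ball_norm_le hW t
  have hslice : ∀ t, ∫⁻ x in B₁, ‖driftField W t x‖ₑ ^ (3 : ℝ) ≤
      volume B₁ * (c ^ (3 : ℝ) * ∫⁻ y in B, ‖W t y‖ₑ ^ (3 : ℝ)) := by
    intro t
    calc ∫⁻ x in B₁, ‖driftField W t x‖ₑ ^ (3 : ℝ)
        ≤ ∫⁻ x in B₁, (c * N t) ^ (3 : ℝ) := lintegral_mono fun x => by gcongr; exact hpt t x
      _ = volume B₁ * (c * N t) ^ (3 : ℝ) := by
          rw [setLIntegral_const, mul_comm]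
      _ = _ := by rw [ENNReal.mul_rpow_of_nonneg _ _ (by norm_num), hN3]
  have hmeasW : AEMeasurable (fun z : ℝ × EuclideanSpace ℝ (Fin 3) => ‖uncurry W z‖ₑ ^ (3 : ℝ))
      (((volume : Measure ℝ).prod (volume : Measure (EuclideanSpace ℝ (Fin 3)))).restrict
        (Ioo (-4 : ℝ) 0 ×ˢ B)) :=
    (hW.stronglyMeasurable.measurable.enorm.pow_const _).aemeasurable
  have hmeash : AEMeasurable
      (fun z : ℝ × EuclideanSpace ℝ (Fin 3) => ‖uncurry (driftField W) z‖ₑ ^ (3 : ℝ))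
      (((volume : Measure ℝ).prod (volume : Measure (EuclideanSpace ℝ (Fin 3)))).restrict
        (Ioo (-1 : ℝ) 0 ×ˢ B₁)) :=
    ((stronglyMeasurable_uncurry_driftField hW).measurable.enorm.pow_const _).aemeasurable
  have hT : ∫⁻ t in Ioo (-4 : ℝ) 0, ∫⁻ y in B, ‖W t y‖ₑ ^ (3 : ℝ) =
      ∫⁻ z in parabolicCylinder 2 (0 : ℝ × EuclideanSpace ℝ (Fin 3)), ‖uncurry W z‖ₑ ^ (3 : ℝ) := by
    rw [parabolicCylinder_two_zero, ← hB, Measure.volume_eq_prod, setLIntegral_prod _ hmeasW]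
    rfl
  have hX : ∫⁻ z in parabolicCylinder 2 (0 : ℝ × EuclideanSpace ℝ (Fin 3)), ‖uncurry W z‖ₑ ^ (3 : ℝ) =
      X ^ (3 : ℝ) := by
    rw [hXdef, hμ₂, eLpNorm_eq_lintegral_rpow_enorm_toReal (by norm_num) (by norm_num),
      ENNReal.toReal_ofNat, ← ENNReal.rpow_mul]
    norm_num
  have hY : eLpNorm (uncurry (driftField W)) 3 μ₁ ^ (3 : ℝ) =
      ∫⁻ z in parabolicCylinder 1 (0 : ℝ × EuclideanSpace ℝ (Fin 3)),
        ‖uncurry (driftField W) z‖ₑ ^ (3 : ℝ) := by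
    rw [hμ₁, eLpNorm_eq_lintegral_rpow_enorm_toReal (by norm_num) (by norm_num),
      ENNReal.toReal_ofNat, ← ENNReal.rpow_mul]
    norm_num
  have hh3 : eLpNorm (uncurry (driftField W)) 3 μ₁ ^ (3 : ℝ) ≤ volume B₁ * (c ^ (3 : ℝ) * X ^ (3 : ℝ)) := by
    rw [hY, parabolicCylinder_one_zero, ← hB₁, Measure.volume_eq_prod, setLIntegral_prod _ hmeash]
    calc ∫⁻ t in Ioo (-1 : ℝ) 0, ∫⁻ x in B₁, ‖uncurry (driftField W) (t, x)‖ₑ ^ (3 : ℝ)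
        ≤ ∫⁻ t in Ioo (-1 : ℝ) 0, volume B₁ * (c ^ (3 : ℝ) * ∫⁻ y in B, ‖W t y‖ₑ ^ (3 : ℝ)) :=
          lintegral_mono fun t => hslice t
      _ ≤ ∫⁻ t in Ioo (-4 : ℝ) 0, volume B₁ * (c ^ (3 : ℝ) * ∫⁻ y in B, ‖W t y‖ₑ ^ (3 : ℝ)) :=
          lintegral_mono_set (Ioo_subset_Ioo (by norm_num) le_rfl)
      _ = volume B₁ * (c ^ (3 : ℝ) * X ^ (3 : ℝ)) := by
          rw [lintegral_const_mul' _ _ hB₁fin,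
            lintegral_const_mul' _ _ (ENNReal.rpow_ne_top_of_nonneg (by norm_num) hctop), hT, hX]
  have hh : eLpNorm (uncurry (driftField W)) 3 μ₁ ≤ volume B₁ ^ (1 / 3 : ℝ) * c * X := by
    have h1 : eLpNorm (uncurry (driftField W)) 3 μ₁ =
        (eLpNorm (uncurry (driftField W)) 3 μ₁ ^ (3 : ℝ)) ^ (1 / 3 : ℝ) := by
      rw [← ENNReal.rpow_mul]; norm_num
    rw [h1]
    calc (eLpNorm (uncurry (driftField W)) 3 μ₁ ^ (3 : ℝ)) ^ (1 / 3 : ℝ)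
        ≤ (volume B₁ * (c ^ (3 : ℝ) * X ^ (3 : ℝ))) ^ (1 / 3 : ℝ) := by gcongr
      _ = volume B₁ ^ (1 / 3 : ℝ) * c * X := by
          rw [ENNReal.mul_rpow_of_nonneg _ _ (by norm_num), ENNReal.mul_rpow_of_nonneg _ _ (by norm_num),
            ← ENNReal.rpow_mul, ← ENNReal.rpow_mul]
          norm_num
          rw [hc]
          ring
  -- ### conclusion
  calc eLpNorm (uncurry fun t x => W t x - driftField W t x) 3 μ₁
      ≤ eLpNorm (uncurry W) 3 μ₁ + eLpNorm (uncurry (driftField W)) 3 μ₁ := htri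
    _ ≤ X + volume B₁ ^ (1 / 3 : ℝ) * c * X := add_le_add hW12 hh
    _ = (1 + volume B₁ ^ (1 / 3 : ℝ) * c) * X := by rw [add_mul, one_mul]
    _ = ENNReal.ofReal (1 + k₁ * (Ch * k)) * X := by
        rw [hK₁, hc', ← ENNReal.ofReal_mul hk₁0, ← ENNReal.ofReal_one,
          ← ENNReal.ofReal_add zero_le_one (by positivity)]

end Kwon2023

end Literature.Analysis.FluidPDE

end
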